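import Literature.Barriers.NavierStokesRegularity.CriticalDataSmoothNonuniqueness
import Literature.Analysis.FunctionSpaces.TorusSpaceTime
import Literature.Analysis.FunctionSpaces.TorusVectorParseval
import HarnessLib

/-!
# Coiculescu–Palasek 2025, Thm. 1.2 — proof architecture: the small-data global extension as a
  named fact, the finite-time construction as the explicit remaining obligation, the glue and
  the assembly proved

Sibling proof file of the barrier entry
`Literature/Barriers/NavierStokesRegularity/CriticalDataSmoothNonuniqueness` (D-0021), working
towards the named fact `CriticalDataSmoothNonuniqueness` (M. P. Coiculescu, S. Palasek,
*Non-uniqueness of smooth solutions of the Navier–Stokes equations from critical data*,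
Invent. Math. 244 (2025), 165–219, arXiv:2503.14699, Thm. 1.2 with Rmk. 1.3: one divergence-free
`BMO⁻¹` datum on `𝕋³`, two distinct global solutions smooth for `t > 0`). Triage: SIZE XL — the
printed proof (§§2–5 with Appendices A–C of the held arXiv text) is a multiscale hard-analysis
construction
(Mikado-flow potentials, an iteratively defined lacunary datum, the semigroup of the
linearisation around the principal part, a fixed point in a slightly subcritical space) over
vocabulary the tree does not have on the torus (Littlewood–Paley projections, Hölder–Zygmund
classes `𝒞^s`, `BMO⁻¹(𝕋³) = div BMO`). This file formalises the TOP LEVEL of the printed proof,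
which is the following two-step shape of its §5:

1. (§§3–4 and §5 up to its last paragraph) everything is built and proved on the paper's unit
   time interval: `u⁽ⁱ⁾ = v⁽ⁱ⁾ + w⁽ⁱ⁾`, `i = 1, 2`, solve (NSE) and are smooth on `(0,1] × 𝕋³` (§5, first
   paragraph; Prop. 4.3), obey `‖u⁽ⁱ⁾(t)‖_∞ ≲ t^{-1/2}` there (Prop. 3.13, the weighted `L^∞` bound
   with `m = 0`, for `v⁽ⁱ⁾`; `w⁽ⁱ⁾ ∈ B_X(0, ε₁)` with the weight `t^{1/2-α/2}` of `X`, §4.3, for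
   `w⁽ⁱ⁾`), attain the common datum `U⁰` in `Ẇ^{-1,p}(𝕋³)`, `1 < p < ∞` (§5, second and third
   paragraphs; `w⁽ⁱ⁾(t) → 0` in `𝒞^{-1+α/2}`, Prop. 4.3), are distinct
   at `t₀ = N₀⁻² ≤ 1` (§5, "Finally, we show that the two solutions are distinct"), and at `t = 1`
   are uniformly as small as we please: `‖∇^m v⁽ⁱ⁾|_{t=1}‖_∞ ≤ exp(-N₀²/O_m(1))` (§5, last
   paragraph; `m = 0`) and `‖w⁽ⁱ⁾(1)‖_∞ ≤ ‖w⁽ⁱ⁾‖_X ≤ ε₁` (the `L^∞` slot of the norm of `X`, §4.3,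
   has weight `t^{1/2-α/2} = 1` at `t = 1`), `ε₁ ∈ (0, C₄⁻¹)` free (Prop. 4.3). This FINITE-TIME
   CONSTRUCTION is the bulk of the printed proof — a slice of the proof of Thm. 1.2, not a
   separately published result — so (D-0026: fact decompositions do not recurse, children of a
   split are distinct M-sized published results) it is NOT a named fact: it is the remaining
   proof obligation of the barrier fact, and appears below only as the EXPLICIT hypothesis `h₁`
   of the assembly theorem `CriticalDataSmoothNonuniqueness_of_parts`. (It was briefly the named
   fact `CoiculescuPalasek2025_construction`; merged back on split review, 2026-08-15.) One level
   down, the sibling file `CriticalDataSmoothNonuniquenessConstruction` proves this hypothesis —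
   and with it the barrier fact — from the paper's principal parts (Def. 3.10, Prop. 3.13,
   Prop. 4.1) and its perturbation theorem (Props. 4.2–4.3).
2. (§5, last paragraph) "Finally, let us extend our solutions on `[0,1]` to be global solutions.
   … `v⁽ⁱ⁾|_{t=1}` can be made arbitrarily small in, say, `H^{1/2}(𝕋³)` or `B^{-1}_{∞,2} ⊂ BMO⁻¹`,
   and existence of a global-in-time solution follows", together with Rmk. 1.3 (the global
   solutions obey `sup_{t>0} t^{1/2}‖u(t)‖_∞ < ∞`): the small-data global theory in a critical
   space on the torus (the paper's own Thm. 1.1 = Koch–Tataru 2001 for `BMO⁻¹ ⊃ L^∞`;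
   Robinson–Rodrigo–Sadowski 2016, §11.2, Thm. 11.4 (ii) for small `L³ ⊃ L^∞` data, valid on the
   torus for mean-zero fields, Lemma 11.2 and §11.3: a unique global solution, smooth for `t > 0`;
   §7.2, Thm. 7.5 with its footnote 3: smooth up to the initial time on the torus for smooth
   data) — a distinct classical result, vendored, in the general form in which it is used, as the
   named fact `CoiculescuPalasek2025_globalExtension`, and DISCHARGED in the sibling file
   `CriticalDataSmoothNonuniquenessGlobal` (`CoiculescuPalasek2025_globalExtension_holds`).

Proved here:

* `continuousInSobolevOn_complexify_of_isSmoothSpaceTimeOn` — glue: a jointly smooth field on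
  `S × 𝕋ᵈ` is continuous in time with values in `H^s(𝕋ᵈ)`, `s ≤ 0` (tube lemma over the compact
  torus, `‖·‖_{H^s} ≤ ‖·‖_{H⁰} = ‖·‖_{L²} ≤ ‖·‖_∞`, Parseval for complexified real fields);
* `CriticalDataSmoothNonuniqueness_of_parts` — the finite-time construction (explicit hypothesis)
  and the global-extension fact imply the barrier fact: extend both finite-time solutions past
  their final time `T`, take the largest of the Koch–Tataru constants, read the `H^{-1}`
  continuity at positive times off the smoothness, and transport the datum clauses and the
  distinctness, which only involve times in `(0,T]`, along the agreement `U = u` on `(0,T]`.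

## Rendering notes

* Time interval. The `2π`-periodic setting is transported to `UnitAddTorus (Fin 3)` by the
  Navier–Stokes scaling `x ↦ 2πx`, `t ↦ 4π²t` (module docstring of the barrier file), under which
  the paper's time interval `(0,1]` becomes `(0, 1/(4π²)]`; hypothesis `h₁` therefore only asserts
  the construction on `Set.Ioc 0 T` for SOME `T > 0` (one-sided time derivative at `t = T`,
  `Torus.IsClassicalNSSolutionOn (Ioc 0 T)`), and the extension fact is the extension past an
  arbitrary `T > 0` (the equations are autonomous). The global object lives on `Set.Ioi 0`, as in
  the barrier fact. (The paper's choice `t = 1` is itself arbitrary: the construction is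
  non-trivial only for `t < N₀⁻²`, footnote to §4.3.)
* Smallness at `t = T` is rendered as UNIFORM smallness `‖u(T)‖_{L^∞} ≤ ε`: in `h₁` this is
  what is printed (`‖v⁽ⁱ⁾(1)‖_∞ ≤ exp(-N₀²/O(1))`, `‖w⁽ⁱ⁾(1)‖_∞ ≤ ε₁`), and in the extension fact it
  is a sufficient smallness for every critical small-data theory on the torus
  (`L^∞ ⊂ L³ ⊂ BMO⁻¹` on the probability space `𝕋³`, mean-zero fields; the paper says "small in,
  say, `H^{1/2}(𝕋³)` or `B^{-1}_{∞,2} ⊂ BMO⁻¹`", and `‖·‖_{B^{-1}_{∞,2}} ≲ ‖·‖_{L^∞}`). We deliberately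
  do not render the `C^{1,κ}` part of the norm of `X`.
* `h₁` is stated "for every `ε > 0`": the free parameters `ε₁ ∈ (0, C₄⁻¹)` (Prop. 4.3) and
  `A` (taken larger, §2.4) make `u⁽ⁱ⁾(1)` as small as desired while all other clauses persist
  (their constants may depend on `ε`).
* Zero mean of `u⁽ⁱ⁾(1)` (needed by the periodic small-data theory, which works modulo
  constants) is implied by Thm. 1.2's `u⁽ⁱ⁾ ∈ L^∞([0,∞); BMO⁻¹(𝕋³))` (nonzero constants are not in
  `BMO⁻¹`: the Carleson norm of the caloric extension of a constant `c` over a box of size `R`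
  is `∼ c²R²`), and is also visible structurally:
  every constituent of `v⁽ⁱ⁾` is a `curl curl` or a Leray projection of a divergence
  (Def. 3.10, Rmk. 3.11) and `w⁽ⁱ⁾` is a time integral of the semigroup `S⁽ⁱ⁾(t,t')` applied to
  `ℙ div`-data (the fixed-point map `T(w)` in the proof of Prop. 4.3 and the definition of `S⁽ⁱ⁾`
  in §4.2, whose evolution preserves the average), so all have zero average on `𝕋³`.
* The datum clauses of `h₁` are copied from the barrier fact (they only involve `t → 0⁺`):
  `Ẇ^{-1,2}(𝕋³) = Ḣ^{-1}(𝕋³)` is `Torus.eHomSobolevSeminorm (-1)`; see the barrier file for why the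
  common datum is expressed by `‖u(t) - v(t)‖_{Ḣ^{-1}} → 0` plus Cauchy-ness and pairings.

## References

* M. P. Coiculescu, S. Palasek, Invent. Math. 244 (2025), 165–219,
  doi:10.1007/s00222-025-01396-z, arXiv:2503.14699: Thm. 1.2, Rmks. 1.3, 1.7, §2.4 (parameters),
  Def. 3.10, Prop. 3.13, Props. 4.1–4.3, §5 (proof of Thm. 1.2). [`CoiculescuPalasek2025`]
* J. C. Robinson, J. L. Rodrigo, W. Sadowski, *The Three-Dimensional Navier–Stokes Equations.
  Classical Theory*, CUP 2016: §11.2, Thm. 11.4 (ii) with Lemma 11.2 and §11.3 (small `L³` data: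
  unique global solution, smooth for `t > 0`; torus with zero mean); §7.2, Thm. 7.5 and footnote
  3 (smoothness of strong solutions, up to `t = 0` on the torus); §6.4, Thm. 6.12.
  [`RobinsonRodrigoSadowskiCUP2016`]
* H. Fujita, T. Kato, ARMA 16 (1964). [`FujitaKato1964`] · H. Koch, D. Tataru, Adv. Math. 157
  (2001), Thm. 2. [`KochTataruAdvMath2001`]
-/

noncomputable section

open MeasureTheory Set Filter
open _root_.Topology
open scoped InnerProductSpace RealInnerProductSpace ENNReal

namespace Literature.Barriers.NavierStokesRegularity

open Literature.Analysis.FunctionSpaces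

/-! ## The small-data global extension (§5, last paragraph), as a named fact -/

/-- **Global extension past a time `T` from small data (Coiculescu–Palasek 2025, §5, last
paragraph, with Rmk. 1.3; classical small-data theory on `𝕋³`).** There is `ε > 0` such that for
every `T > 0`, every classical solution `(u, p)` of the unforced Navier–Stokes equations (`ν = 1`)
on `(0,T] × 𝕋³` whose (smooth, divergence-free) value `u(T)` has zero mean and sup-norm
`‖u(T)‖_{L^∞} ≤ ε` extends to a classical solution `(U, P)` on `(0,∞) × 𝕋³`, `U = u` on `(0,T]`,
obeying the Koch–Tataru-type bound `√t ‖U(t)‖_{L^∞} ≤ C` for all `t ≥ T`. In print: "Finally, let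
us extend our solutions on `[0,1]` to be global solutions. … `v⁽ⁱ⁾|_{t=1}` can be made arbitrarily
small in, say, `H^{1/2}(𝕋³)` or `B^{-1}_{∞,2} ⊂ BMO⁻¹`, and existence of a global-in-time solution
follows" (§5) and "our solutions obey … `sup_{t>0} t^{1/2}‖u(t)‖_{L^∞} + … < ∞`" (Rmk. 1.3). The
classical input, for the record: on the probability space `𝕋³` a mean-zero field with
`‖u(T)‖_{L^∞} ≤ ε` is `ε`-small in `L³` and `O(ε)`-small in `BMO⁻¹`, so the small-data global
theory in a critical space applies — the paper's Thm. 1.1 (Koch–Tataru 2001: unique global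
solution, regular for `t > 0`, with `sup_{s>0} s^{1/2}‖·‖_∞` part of the solution norm), or
Robinson–Rodrigo–Sadowski 2016, §11.2, Thm. 11.4 (ii) (small `L³` data, on the torus for mean-zero
fields by Lemma 11.2 and §11.3: unique global solution, smooth for `t > 0`); the solution from
the smooth datum `u(T)` is smooth up to its initial time on the torus (ibid., §7.2, Thm. 7.5 and
footnote 3) and glues smoothly to `u` at `t = T` (all one-sided time derivatives at `t = T` are
determined by `u(T)` through the equations; the pressure is renormalised by a function of time);
near `t = T` the bound holds by continuity, for large `t` by the decay of the small global
solution; the threshold is independent of `T` (the equations are autonomous). Discharged: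
`CoiculescuPalasek2025_globalExtension_holds` (sibling file
`CriticalDataSmoothNonuniquenessGlobal`).
[cite: CoiculescuPalasek2025, §5 (last paragraph) with Thm. 1.1 and Rmk. 1.3] -/
def CoiculescuPalasek2025_globalExtension : Prop :=
  ∃ ε : ℝ, 0 < ε ∧
    ∀ (T : ℝ), 0 < T →
    ∀ (u : ℝ → UnitAddTorus (Fin 3) → EuclideanSpace ℝ (Fin 3))
      (p : ℝ → UnitAddTorus (Fin 3) → ℝ),
      Torus.IsClassicalNSSolutionOn (Ioc 0 T) 1 0 u p →
      Torus.HasZeroMean (u T) →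
      (∀ x, ‖u T x‖ ≤ ε) →
      ∃ (U : ℝ → UnitAddTorus (Fin 3) → EuclideanSpace ℝ (Fin 3))
        (P : ℝ → UnitAddTorus (Fin 3) → ℝ),
        Torus.IsClassicalNSSolutionOn (Ioi 0) 1 0 U P ∧
        (∀ t ∈ Ioc (0 : ℝ) T, U t = u t) ∧
        ∃ C : ℝ, ∀ t : ℝ, T ≤ t → ∀ x, Real.sqrt t * ‖U t x‖ ≤ C

/-! ## Glue: jointly smooth fields are continuous in time with values in `H^s`, `s ≤ 0` -/

/-- **Smooth space–time fields are `C⁰_t H^s_x` for `s ≤ 0`.** If `u : ℝ → 𝕋ᵈ → ℝᵈ` is jointly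
smooth on `S × 𝕋ᵈ` (`Torus.IsSmoothSpaceTimeOn S u`), then `t ↦ complexify ∘ u t` lies in
`C⁰(S; H^s(𝕋ᵈ))` (`Torus.ContinuousInSobolevOn S s`) for every `s ≤ 0`: each slice is continuous,
hence in `L² = H⁰ ⊆ H^s` (`Torus.memSobolev_zero_complexify`), and
`‖u(t) - u(t₀)‖_{H^s} ≤ ‖u(t) - u(t₀)‖_{H⁰} = ‖u(t) - u(t₀)‖_{L²} ≤ sup_x ‖u(t,x) - u(t₀,x)‖ → 0` as
`t → t₀` within `S`, by the tube lemma over the compact torus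
(`Torus.IsSmoothSpaceTimeOn.eventually_norm_sub_lt`) and Parseval for complexified real fields
(`Torus.eSobolevNorm_zero_complexify`). This is the (folklore) step "smooth solutions are
continuous into `H^{-1}` at positive times" of the barrier's rendering. [folklore] -/
theorem continuousInSobolevOn_complexify_of_isSmoothSpaceTimeOn {d : Type*} [Fintype d]
    {S : Set ℝ} {u : ℝ → UnitAddTorus d → EuclideanSpace ℝ d}
    (hu : Torus.IsSmoothSpaceTimeOn S u) {s : ℝ} (hs : s ≤ 0) :
    Torus.ContinuousInSobolevOn S s (fun t => EuclideanSpace.complexify ∘ u t) := by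
  -- continuous fields on the compact probability space `𝕋ᵈ` are square integrable
  have hL2 : ∀ {w : UnitAddTorus d → EuclideanSpace ℝ d}, Continuous w → MemLp w 2 volume :=
    fun hw => hw.memLp_of_hasCompactSupport (HasCompactSupport.of_compactSpace _)
  have hcont : ∀ t ∈ S, Continuous (u t) := fun t ht => (hu.isSmooth_slice ht).continuous
  refine ⟨fun t ht => (Torus.memSobolev_zero_complexify (hL2 (hcont t ht))).mono hs,
    fun t₀ ht₀ => ?_⟩
  refine ENNReal.tendsto_nhds_zero.2 fun ε hε => ?_
  obtain ⟨r, -, hr0, hrε⟩ := ENNReal.lt_iff_exists_real_btwn.1 hε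
  have hr : 0 < r := ENNReal.ofReal_pos.1 hr0
  filter_upwards [hu.eventually_norm_sub_lt ht₀ hr, eventually_mem_nhdsWithin] with t ht htS
  have hdiff : Continuous (u t - u t₀) := (hcont t htS).sub (hcont t₀ ht₀)
  have hfun : EuclideanSpace.complexify ∘ u t - EuclideanSpace.complexify ∘ u t₀ =
      EuclideanSpace.complexify ∘ (u t - u t₀) := by
    funext x
    simp [map_sub]
  show Torus.eSobolevNorm s
      (EuclideanSpace.complexify ∘ u t - EuclideanSpace.complexify ∘ u t₀) ≤ ε
  rw [hfun]
  calc Torus.eSobolevNorm s (EuclideanSpace.complexify ∘ (u t - u t₀))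
      ≤ Torus.eSobolevNorm 0 (EuclideanSpace.complexify ∘ (u t - u t₀)) :=
        Torus.eSobolevNorm_mono hs _
    _ = eLpNorm (u t - u t₀) 2 volume := Torus.eSobolevNorm_zero_complexify (hL2 hdiff)
    _ ≤ ENNReal.ofReal r := by
        refine (eLpNorm_le_of_ae_bound (C := r)
          (Eventually.of_forall fun x => (ht x).le)).trans ?_
        simp
    _ ≤ ε := hrε.le

/-! ## The assembly -/

/-- **The §5 sentence, proved**: the finite-time construction and the small-data global
extension (`CoiculescuPalasek2025_globalExtension`) imply the barrier fact
`CriticalDataSmoothNonuniqueness`.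

Hypothesis `h₁` is **Coiculescu–Palasek 2025, the construction on a finite time interval**
(§§3–4 and §5 up to its last paragraph, where everything happens on the paper's `(0,1] × 𝕋³`,
`𝕋³ = ℝ³/(2πℤ)³`; transported to the unit torus, on which the final time becomes some `T > 0`),
stated explicitly — it is the remaining proof obligation of the barrier fact, not a named fact
(D-0026; see the module docstring), and it is proved from the principal parts and the
perturbation theorem of the paper in the sibling file `CriticalDataSmoothNonuniquenessConstruction`.
It reads: for every `ε > 0` there are `T > 0` and two classical solutions `(u, p₁)`, `(v, p₂)` of
the unforced Navier–Stokes equations (`ν = 1`) on `(0,T] × 𝕋³` (§5, first paragraph: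
`u⁽ⁱ⁾ = v⁽ⁱ⁾ + w⁽ⁱ⁾` obey (NSE) and are smooth on `(0,1] × 𝕋³`; Prop. 4.3) such that: both obey
`√t ‖u(t)‖_{L^∞} ≤ M` for `t ∈ (0,T]` (Prop. 3.13 with `m = 0` for the principal parts;
`‖w⁽ⁱ⁾(t)‖_∞ ≤ ε₁ t^{-1/2+α/2}` from `w⁽ⁱ⁾ ∈ B_X(0,ε₁)`, §4.3); they differ at some `t₀ ∈ (0,T]` (§5:
at `t₀ = N₀⁻² ≤ 1`); they issue from the same datum — `‖u(t) - v(t)‖_{Ḣ^{-1}} → 0`, each of `u(t)`,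
`v(t)` Cauchy in `Ḣ^{-1}` as `t → 0⁺`, and for smooth mean-zero test fields the pairings converge
with difference tending to `0` (§5, second and third paragraphs: both attain `U⁰` in
`Ẇ^{-1,p}(𝕋³)`, `1 < p < ∞`, and `w⁽ⁱ⁾(t) → 0` in `𝒞^{-1+α/2} ⊂ Ẇ^{-1,2} = Ḣ^{-1}`, Prop. 4.3; the
`p = 2` instance and duality, as in the barrier fact); and at `t = T` both have zero mean
(Thm. 1.2: `u⁽ⁱ⁾ ∈ L^∞_t BMO⁻¹(𝕋³)`, and a periodic `BMO⁻¹` field has zero average; also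
structurally, Def. 3.10 and §§4.2–4.3: all constituents are `curl curl`'s, Leray projections of
divergences, or time integrals of the mean-preserving linearised flow from such) and sup-norm at
most `ε` (§5, last paragraph: `‖∇^m v⁽ⁱ⁾|_{t=1}‖_∞ ≤ exp(-N₀²/O_m(1))`, arbitrarily small for `A`
large, used with `m = 0`; Prop. 4.3: `w⁽ⁱ⁾ ∈ B_X(0, ε₁)` with `ε₁ ∈ (0, C₄⁻¹)` free, and the `L^∞`
slot `t^{1/2-α/2}‖·‖_{L^∞}` of the norm of `X` (§4.3) has weight `1` at `t = 1`, so
`‖w⁽ⁱ⁾(1)‖_∞ ≤ ε₁`). See the module docstring for the rendering choices (`∃ T`, sup-norm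
smallness, "for every `ε`", zero mean).

Lean content of "existence of a global-in-time solution follows": with `ε` the threshold of the
extension fact, run the construction, extend both solutions past their final time `T`; the
global Koch–Tataru constant is the maximum of the finite-time one and the two extension
constants; `H^{-1}` continuity at positive times is
`continuousInSobolevOn_complexify_of_isSmoothSpaceTimeOn` applied to the smooth velocities;
distinctness (at `t₀ ≤ T`) and the four datum clauses (filters at `0⁺`, along which `(0,T]` is
eventually entered, `Ioc_mem_nhdsGT`) transport along `U = u`, `V = v` on `(0,T]`.
[cite: CoiculescuPalasek2025, §5 (proof of Thm. 1.2) with Props. 3.13 and 4.3] -/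
theorem CriticalDataSmoothNonuniqueness_of_parts
    (h₁ : ∀ ε : ℝ, 0 < ε →
      ∃ T : ℝ, 0 < T ∧
      ∃ (u v : ℝ → UnitAddTorus (Fin 3) → EuclideanSpace ℝ (Fin 3))
        (p₁ p₂ : ℝ → UnitAddTorus (Fin 3) → ℝ),
        Torus.IsClassicalNSSolutionOn (Ioc 0 T) 1 0 u p₁ ∧
        Torus.IsClassicalNSSolutionOn (Ioc 0 T) 1 0 v p₂ ∧
        (∃ M : ℝ, ∀ t ∈ Ioc (0 : ℝ) T, ∀ x,
          Real.sqrt t * ‖u t x‖ ≤ M ∧ Real.sqrt t * ‖v t x‖ ≤ M) ∧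
        (∃ t₀ ∈ Ioc (0 : ℝ) T, u t₀ ≠ v t₀) ∧
        Tendsto (fun t =>
            Torus.eHomSobolevSeminorm (-1) (EuclideanSpace.complexify ∘ (u t - v t)))
          (𝓝[>] 0) (𝓝 0) ∧
        Tendsto (fun st : ℝ × ℝ =>
            Torus.eHomSobolevSeminorm (-1) (EuclideanSpace.complexify ∘ (u st.1 - u st.2)))
          ((𝓝[>] (0 : ℝ)) ×ˢ (𝓝[>] (0 : ℝ))) (𝓝 0) ∧
        Tendsto (fun st : ℝ × ℝ =>
            Torus.eHomSobolevSeminorm (-1) (EuclideanSpace.complexify ∘ (v st.1 - v st.2)))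
          ((𝓝[>] (0 : ℝ)) ×ˢ (𝓝[>] (0 : ℝ))) (𝓝 0) ∧
        (∀ φ : UnitAddTorus (Fin 3) → EuclideanSpace ℝ (Fin 3),
          Torus.IsSmooth φ → Torus.HasZeroMean φ →
          (∃ c : ℝ, Tendsto (fun t => ∫ x, ⟪u t x, φ x⟫) (𝓝[>] 0) (𝓝 c)) ∧
          (∃ c : ℝ, Tendsto (fun t => ∫ x, ⟪v t x, φ x⟫) (𝓝[>] 0) (𝓝 c)) ∧
          Tendsto (fun t => ∫ x, ⟪u t x - v t x, φ x⟫) (𝓝[>] 0) (𝓝 0)) ∧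
        Torus.HasZeroMean (u T) ∧ Torus.HasZeroMean (v T) ∧
        (∀ x, ‖u T x‖ ≤ ε ∧ ‖v T x‖ ≤ ε))
    (h₂ : CoiculescuPalasek2025_globalExtension) :
    CriticalDataSmoothNonuniqueness := by
  obtain ⟨ε, hε, hext⟩ := h₂
  obtain ⟨T, hT, u, v, p₁, p₂, hu, hv, ⟨M, hM⟩, ⟨t₀, ht₀, hne⟩, hdat, hcu, hcv, hφ, hmu, hmv,
    hs⟩ := h₁ ε hε
  obtain ⟨U, P, hU, hUu, CU, hCU⟩ := hext T hT u p₁ hu hmu fun x => (hs x).1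
  obtain ⟨V, Q, hV, hVv, CV, hCV⟩ := hext T hT v p₂ hv hmv fun x => (hs x).2
  -- agreement with the finite-time solutions, eventually along `t → 0⁺`
  have hI : Ioc (0 : ℝ) T ∈ 𝓝[>] (0 : ℝ) := Ioc_mem_nhdsGT hT
  have hEU : ∀ᶠ t in 𝓝[>] (0 : ℝ), U t = u t := eventually_of_mem hI fun t ht => hUu t ht
  have hEV : ∀ᶠ t in 𝓝[>] (0 : ℝ), V t = v t := eventually_of_mem hI fun t ht => hVv t ht
  have hEU2 : ∀ᶠ st in (𝓝[>] (0 : ℝ)) ×ˢ (𝓝[>] (0 : ℝ)), U st.1 = u st.1 ∧ U st.2 = u st.2 :=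
    hEU.prod_mk hEU
  have hEV2 : ∀ᶠ st in (𝓝[>] (0 : ℝ)) ×ˢ (𝓝[>] (0 : ℝ)), V st.1 = v st.1 ∧ V st.2 = v st.2 :=
    hEV.prod_mk hEV
  refine ⟨U, V, P, Q, hU, hV, ⟨max M (max CU CV), fun t ht x => ?_⟩,
    continuousInSobolevOn_complexify_of_isSmoothSpaceTimeOn hU.smooth_velocity (by norm_num),
    continuousInSobolevOn_complexify_of_isSmoothSpaceTimeOn hV.smooth_velocity (by norm_num),
    ⟨t₀, ht₀.1, ?_⟩, ?_, ?_, ?_, fun φ hφs hφm => ?_⟩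
  · -- the Koch–Tataru bound: finite-time constant on `(0,T]`, extension constants on `[T,∞)`
    rcases le_or_gt t T with h1 | h1
    · rw [hUu t ⟨ht, h1⟩, hVv t ⟨ht, h1⟩]
      exact ⟨(hM t ⟨ht, h1⟩ x).1.trans (le_max_left _ _),
        (hM t ⟨ht, h1⟩ x).2.trans (le_max_left _ _)⟩
    · exact ⟨(hCU t h1.le x).trans ((le_max_left _ _).trans (le_max_right _ _)),
        (hCV t h1.le x).trans ((le_max_right _ _).trans (le_max_right _ _))⟩
  · -- distinct at `t₀ ∈ (0,T]`
    rw [hUu t₀ ht₀, hVv t₀ ht₀]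
    exact hne
  · -- common datum in `Ḣ^{-1}`
    refine hdat.congr' ?_
    filter_upwards [hEU, hEV] with t h1 h2
    rw [h1, h2]
  · -- `U(t)` Cauchy in `Ḣ^{-1}` as `t → 0⁺`
    refine hcu.congr' ?_
    filter_upwards [hEU2] with st hst
    rw [hst.1, hst.2]
  · -- `V(t)` Cauchy in `Ḣ^{-1}` as `t → 0⁺`
    refine hcv.congr' ?_
    filter_upwards [hEV2] with st hst
    rw [hst.1, hst.2]
  · -- distributional pairings against smooth mean-zero test fields
    obtain ⟨⟨c₁, hc₁⟩, ⟨c₂, hc₂⟩, h0⟩ := hφ φ hφs hφm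
    refine ⟨⟨c₁, hc₁.congr' ?_⟩, ⟨c₂, hc₂.congr' ?_⟩, h0.congr' ?_⟩
    · filter_upwards [hEU] with t ht
      rw [ht]
    · filter_upwards [hEV] with t ht
      rw [ht]
    · filter_upwards [hEU, hEV] with t h1 h2
      rw [h1, h2]

end Literature.Barriers.NavierStokesRegularity
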